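import Literature.MathematicalPhysics.QuantumLattice.GibbsPressureTemperature
import HarnessLib

/-!
# The von Neumann entropy of a finite-dimensional Gibbs state

Topic `Literature/MathematicalPhysics/QuantumLattice` (thermal toolkit: `FinDimSpectrum.lean` has
`Matrix.partitionFn`, `Matrix.gibbsState`; `DuhamelTwoPoint.lean` the Peierls–Bogoliubov inequality
and the energy–entropy bound; `GibbsPressureTemperature.lean` the temperature dependence of
`log Z_β`). This file names the ENTROPY of the Gibbs state and proves its elementary properties:

* `Matrix.gibbsEntropy β H = log Z_β(H) + β Re⟨H⟩_β` (dot-notation extension of Mathlib's `Matrix`,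
  like `Matrix.partitionFn`): for Hermitian `H` this is the von Neumann entropy
  `S(ρ_β) = -tr ρ_β log ρ_β` of `ρ_β = e^{-βH}/Z_β` (`IsHermitian.gibbsEntropy_eq_neg_sum_mul_log`:
  `S = -Σᵢ pᵢ log pᵢ`, `pᵢ = e^{-βEᵢ}/Z_β` the Boltzmann weights of the eigenvalues);
* `0 ≤ S_β ≤ log dim` (`gibbsEntropy_nonneg`, `gibbsEntropy_le_log_card`), `S_0 = log dim`;
* the mean energy `Re⟨H⟩_β` and the entropy `S_β` are antitone in `β` (non-decreasing in the
  temperature): `re_gibbsState_self_antitone`, `gibbsEntropy_antitone` — both from the convexity of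
  `β ↦ log Z_β` (`log_partitionFn_sub_mul_energy_le`), no differentiation;
* the dyadic sandwich `S_β ≤ 2 log Z_{β/2} − log Z_β ≤ S_{β/2}` between entropies and pressure
  increments (`gibbsEntropy_le_two_mul_log_partitionFn_half_sub`,
  `two_mul_log_partitionFn_half_sub_le_gibbsEntropy_half`), and the general increment bound
  `β'⁻¹ log Z_{β'} − β⁻¹ log Z_β ≤ ((β − β')/(ββ')) S_{β'}` (`pressure_sub_pressure_le_gibbsEntropy`).

Consumers: Hubbard route `ThermalWedge` (the registered stub `stub_entropyDensity` of crux
`TwSourcedInertness` is `gibbsEntropy β (hubbardTorusWith 2 L 1 U μ) ≤ C L²/β`, unfolded), and any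
entropy bookkeeping at positive temperature (entropy sandwiches `e ≤ f + T s`).

Sources: J. von Neumann (1927/1932) for `S = -tr ρ log ρ`; the listed properties are textbook
(Bratteli–Robinson, *Operator Algebras and Quantum Statistical Mechanics* II, §5.3.1 and
Prop. 6.2.22ff (finite systems: Gibbs state maximises `S − βE`); Ruelle, *Statistical Mechanics*
(1969) §2; Wehrl, Rev. Mod. Phys. 50 (1978) 221, §II). Finite-dimensional matrix statements:
folklore. Tree search: `lean search 'ntropy'` in `QuantumLattice` — only the Shannon bookkeeping
`neg_sum_mul_log_le` / `sum_boltzmann_mul_le` of `DuhamelTwoPoint.lean` (reused here); Mathlib has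
no von Neumann entropy of density matrices at this pin.
-/

noncomputable section

open scoped ComplexOrder
open Finset Literature.MathematicalPhysics.QuantumLattice

namespace Matrix

variable {n : Type*} [Fintype n] [DecidableEq n]

/-- (Dot-notation extension of Mathlib's `Matrix`.) The **entropy of the Gibbs state** of `H` at
inverse temperature `β`: `S_β(H) = log Z_β(H) + β Re⟨H⟩_β` with `Z_β = tr e^{-βH}` and `⟨·⟩_β` the
Gibbs state. For Hermitian `H` this equals the von Neumann entropy `-tr ρ_β log ρ_β` of
`ρ_β = e^{-βH}/Z_β` (`IsHermitian.gibbsEntropy_eq_neg_sum_mul_log`). Junk (but harmless) for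
non-Hermitian `H` or empty `n`. [folklore] -/
def gibbsEntropy (β : ℝ) (H : Matrix n n ℂ) : ℝ :=
  Real.log (partitionFn β H).re + β * (gibbsState β H H).re

/-- Unfolding lemma for `gibbsEntropy`. [folklore] -/
theorem gibbsEntropy_def (β : ℝ) (H : Matrix n n ℂ) :
    gibbsEntropy β H = Real.log (partitionFn β H).re + β * (gibbsState β H H).re := rfl

/-- At infinite temperature the entropy is `log dim`: `S_0 = log (card n)`. [folklore] -/
theorem gibbsEntropy_zero (H : Matrix n n ℂ) : gibbsEntropy 0 H = Real.log (Fintype.card n) := by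
  rw [gibbsEntropy, zero_mul, add_zero, partitionFn, gibbsWeight_zero, trace_one]
  simp

section Spectral

/-- The mean energy in the eigenbasis: `Re⟨H⟩_β = (Σᵢ e^{-βEᵢ})⁻¹ Σᵢ e^{-βEᵢ} Eᵢ`. [folklore] -/
theorem IsHermitian.re_gibbsState_self {H : Matrix n n ℂ} (hH : H.IsHermitian) (β : ℝ) :
    (gibbsState β H H).re =
      (∑ i, Real.exp (-(β * hH.eigenvalues i)))⁻¹ *
        ∑ i, Real.exp (-(β * hH.eigenvalues i)) * hH.eigenvalues i := by
  set U := (hH.eigenvectorUnitary : Matrix n n ℂ) with hU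
  set E := hH.eigenvalues with hE
  rw [hH.re_gibbsState, hH.gibbsWeight_eq β, ← hU, trace_unitary_conj_mul,
    hH.star_mul_self_mul_eq_diagonal, ← hE, trace, Complex.re_sum]
  congr 1
  refine sum_congr rfl fun i _ => ?_
  rw [diag_apply, diagonal_mul, diagonal_apply_eq, ← Complex.ofReal_mul, Complex.ofReal_re]

/-- `log Z_β = log Σᵢ e^{-βEᵢ}`. [folklore] -/
theorem IsHermitian.log_partitionFn_re {H : Matrix n n ℂ} (hH : H.IsHermitian) (β : ℝ) :
    Real.log (partitionFn β H).re = Real.log (∑ i, Real.exp (-(β * hH.eigenvalues i))) := by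
  rw [hH.partitionFn_eq_ofReal, Complex.ofReal_re]

variable [Nonempty n]

/-- **The Gibbs entropy is the Shannon entropy of the Boltzmann weights**:
`S_β = -Σᵢ pᵢ log pᵢ`, `pᵢ = e^{-βEᵢ}/Σⱼ e^{-βEⱼ}` (i.e. the von Neumann entropy `-tr ρ_β log ρ_β`,
`ρ_β` being diagonal in the eigenbasis of `H` with entries `pᵢ`). [folklore] -/
theorem IsHermitian.gibbsEntropy_eq_neg_sum_mul_log {H : Matrix n n ℂ} (hH : H.IsHermitian)
    (β : ℝ) :
    gibbsEntropy β H =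
      -∑ i, (∑ j, Real.exp (-(β * hH.eigenvalues j)))⁻¹ * Real.exp (-(β * hH.eigenvalues i)) *
        Real.log ((∑ j, Real.exp (-(β * hH.eigenvalues j)))⁻¹ *
          Real.exp (-(β * hH.eigenvalues i))) := by
  set Z : ℝ := ∑ j, Real.exp (-(β * hH.eigenvalues j)) with hZ
  have hZpos : 0 < Z := hH.sum_exp_pos β
  have hlog : ∀ i, Real.log (Z⁻¹ * Real.exp (-(β * hH.eigenvalues i))) =
      -(β * hH.eigenvalues i) - Real.log Z := by
    intro i
    rw [Real.log_mul (inv_pos.2 hZpos).ne' (Real.exp_pos _).ne', Real.log_inv, Real.log_exp]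
    ring
  simp_rw [hlog]
  rw [gibbsEntropy, hH.log_partitionFn_re, hH.re_gibbsState_self, ← hZ]
  have hsum1 : ∑ i, Z⁻¹ * Real.exp (-(β * hH.eigenvalues i)) = 1 := by
    rw [← mul_sum, ← hZ, inv_mul_cancel₀ hZpos.ne']
  have hrhs : -∑ i, Z⁻¹ * Real.exp (-(β * hH.eigenvalues i)) *
        (-(β * hH.eigenvalues i) - Real.log Z) =
      ∑ i, (β * (Z⁻¹ * (Real.exp (-(β * hH.eigenvalues i)) * hH.eigenvalues i)) +
        Real.log Z * (Z⁻¹ * Real.exp (-(β * hH.eigenvalues i)))) := by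
    rw [← sum_neg_distrib]
    refine sum_congr rfl fun i _ => ?_
    ring
  rw [hrhs, sum_add_distrib, ← Finset.mul_sum _ _ β, ← Finset.mul_sum _ _ (Real.log Z),
    ← Finset.mul_sum _ _ Z⁻¹, hsum1, mul_one, add_comm]

/-- **The Gibbs entropy is non-negative** (`0 < pᵢ ≤ 1`). [folklore] -/
theorem IsHermitian.gibbsEntropy_nonneg {H : Matrix n n ℂ} (hH : H.IsHermitian) (β : ℝ) :
    0 ≤ gibbsEntropy β H := by
  set Z : ℝ := ∑ j, Real.exp (-(β * hH.eigenvalues j)) with hZ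
  have hZpos : 0 < Z := hH.sum_exp_pos β
  rw [hH.gibbsEntropy_eq_neg_sum_mul_log β, ← hZ, neg_nonneg]
  refine sum_nonpos fun i _ => ?_
  have hp : 0 < Z⁻¹ * Real.exp (-(β * hH.eigenvalues i)) :=
    mul_pos (inv_pos.2 hZpos) (Real.exp_pos _)
  have hp1 : Z⁻¹ * Real.exp (-(β * hH.eigenvalues i)) ≤ 1 := by
    rw [inv_mul_le_iff₀ hZpos, mul_one]
    exact single_le_sum (f := fun j => Real.exp (-(β * hH.eigenvalues j)))
      (fun j _ => (Real.exp_pos _).le) (mem_univ i)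
  exact mul_nonpos_of_nonneg_of_nonpos hp.le (Real.log_nonpos hp.le hp1)

/-- **The Gibbs entropy is at most `log dim`** (Shannon bound `-Σ pᵢ log pᵢ ≤ log N`). [folklore] -/
theorem IsHermitian.gibbsEntropy_le_log_card {H : Matrix n n ℂ} (hH : H.IsHermitian) (β : ℝ) :
    gibbsEntropy β H ≤ Real.log (Fintype.card n) := by
  set Z : ℝ := ∑ j, Real.exp (-(β * hH.eigenvalues j)) with hZ
  have hZpos : 0 < Z := hH.sum_exp_pos β
  rw [hH.gibbsEntropy_eq_neg_sum_mul_log β, ← hZ]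
  have hp : ∀ i, 0 < Z⁻¹ * Real.exp (-(β * hH.eigenvalues i)) := fun i =>
    mul_pos (inv_pos.2 hZpos) (Real.exp_pos _)
  have hp1 : ∑ i, Z⁻¹ * Real.exp (-(β * hH.eigenvalues i)) = 1 := by
    rw [← mul_sum, ← hZ, inv_mul_cancel₀ hZpos.ne']
  exact neg_sum_mul_log_le hp hp1

/-- **The mean energy is antitone in `β`** (non-decreasing in the temperature): for
`0 < β' ≤ β`, `Re⟨H⟩_β ≤ Re⟨H⟩_{β'}` — add the two supporting lines of the convex `β ↦ log Z_β`
at `β` and at `β'`. [folklore] -/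
theorem IsHermitian.re_gibbsState_self_antitone {H : Matrix n n ℂ} (hH : H.IsHermitian)
    {β β' : ℝ} (hβ' : 0 < β') (hle : β' ≤ β) :
    (gibbsState β H H).re ≤ (gibbsState β' H H).re := by
  have hβ : 0 < β := lt_of_lt_of_le hβ' hle
  rcases eq_or_lt_of_le hle with h | h
  · rw [h]
  have h1 := log_partitionFn_sub_mul_energy_le hH β hβ'
  have h2 := log_partitionFn_sub_mul_energy_le hH β' hβ
  have h3 : 0 ≤ (β - β') * ((gibbsState β' H H).re - (gibbsState β H H).re) := by nlinarith
  have h4 : 0 < β - β' := by linarith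
  nlinarith

/-- **The entropy is antitone in `β`** (the Gibbs entropy does not decrease with the temperature):
for `0 < β' ≤ β`, `S_β ≤ S_{β'}`. From the supporting line at `β` read at `β'` and the
monotonicity of the energy: `S_β − S_{β'} ≤ β'(Re⟨H⟩_β − Re⟨H⟩_{β'}) ≤ 0`. [folklore] -/
theorem IsHermitian.gibbsEntropy_antitone {H : Matrix n n ℂ} (hH : H.IsHermitian) {β β' : ℝ}
    (hβ' : 0 < β') (hle : β' ≤ β) :
    gibbsEntropy β H ≤ gibbsEntropy β' H := by
  have hβ : 0 < β := lt_of_lt_of_le hβ' hle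
  have h1 := log_partitionFn_sub_mul_energy_le hH β' hβ
  have h2 := hH.re_gibbsState_self_antitone hβ' hle
  rw [gibbsEntropy, gibbsEntropy]
  nlinarith

end Spectral

section Sandwich

variable [Nonempty n]

/-- **Pressure increments are paid in entropy**: for `β, β' > 0`,
`β'⁻¹ log Z_{β'} − β⁻¹ log Z_β ≤ ((β − β')/(ββ')) S_{β'}`. [folklore] -/
theorem IsHermitian.pressure_sub_pressure_le_gibbsEntropy {H : Matrix n n ℂ} (hH : H.IsHermitian)
    {β β' : ℝ} (hβ : 0 < β) (hβ' : 0 < β') :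
    Real.log (partitionFn β' H).re / β' - Real.log (partitionFn β H).re / β ≤
      (β - β') / (β * β') * gibbsEntropy β' H :=
  pressure_sub_pressure_le_entropy hH hβ hβ'

/-- **Lower half of the dyadic sandwich**: `S_β ≤ 2 log Z_{β/2} − log Z_β` (`β > 0`). [folklore] -/
theorem IsHermitian.gibbsEntropy_le_two_mul_log_partitionFn_half_sub {H : Matrix n n ℂ}
    (hH : H.IsHermitian) {β : ℝ} (hβ : 0 < β) :
    gibbsEntropy β H ≤ 2 * Real.log (partitionFn (β / 2) H).re - Real.log (partitionFn β H).re :=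
  entropy_le_two_mul_log_partitionFn_half_sub hH hβ

/-- **Upper half of the dyadic sandwich**: `2 log Z_{β/2} − log Z_β ≤ S_{β/2}` (`β > 0`), i.e.
the dyadic pressure increment `β[p(β/2) − p(β)]` lies between the entropies at the two ends.
[folklore] -/
theorem IsHermitian.two_mul_log_partitionFn_half_sub_le_gibbsEntropy_half {H : Matrix n n ℂ}
    (hH : H.IsHermitian) {β : ℝ} (hβ : 0 < β) :
    2 * Real.log (partitionFn (β / 2) H).re - Real.log (partitionFn β H).re ≤
      gibbsEntropy (β / 2) H := by
  have h := pressure_sub_pressure_le_entropy hH hβ (half_pos hβ)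
  rw [← gibbsEntropy_def] at h
  set A := Real.log (partitionFn (β / 2) H).re
  set B := Real.log (partitionFn β H).re
  set S := gibbsEntropy (β / 2) H
  have hβ0 : β ≠ 0 := hβ.ne'
  have hfac : (β - β / 2) / (β * (β / 2)) = 1 / β := by
    field_simp
    ring
  have e1 : A / (β / 2) = 2 * A / β := by
    field_simp
  have key : (2 * A - B) / β ≤ S / β := by
    calc (2 * A - B) / β = A / (β / 2) - B / β := by rw [sub_div, e1]
      _ ≤ (β - β / 2) / (β * (β / 2)) * S := h
      _ = S / β := by rw [hfac, one_div, inv_mul_eq_div]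
  have e : ∀ x : ℝ, x / β * β = x := fun x => div_mul_cancel₀ x hβ0
  have := mul_le_mul_of_nonneg_right key hβ.le
  rwa [e, e] at this

end Sandwich

end Matrix
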